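import Summits.Langlands.Langlands.Theses.FiniteLevelTorsionSplit

/-!
# Route FiniteLevelTorsionSplit — Assembly

The assembly item (stmt-Langlands-26854) of the child route `FiniteLevelTorsionSplit` (decomp-langlands lens-4 gen 18; refines TA = TorsionAvatarReduction.TorsionAvatarAutomorphy, stmt-Langlands-28545) for the Langlands summit:
`DefectZeroTorsionAutomorphy → PositiveDefectTorsionAutomorphy → FiniteLevelNormalForm → TorsionAvatarFrame → Langlands`.

This is literally the type of the route file's sorry-free deciding theorem `Summit.Langlands.Langlands.Theses.FiniteLevelTorsionSplit.closes`.
Nothing here proves `Langlands`: the assembly records only that the ledger items of the route, taken together, imply the summit statement.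
-/

set_option linter.dupNamespace false -- project-wide option (lakefile weak.linter.dupNamespace); `Summit.Langlands.Langlands` is the mandated namespace

namespace Summit.Langlands.Langlands.Theorems

/-- **Assembly of route FiniteLevelTorsionSplit** (stmt-Langlands-26854).  Proof: unfold `Assembly` and apply the route's deciding theorem `Theses.FiniteLevelTorsionSplit.closes`. -/
theorem finiteLevelTorsionSplit_assembly_proof :
    Summit.Langlands.Langlands.Theses.FiniteLevelTorsionSplit.Assembly := by
  unfold Summit.Langlands.Langlands.Theses.FiniteLevelTorsionSplit.Assembly
  exact Summit.Langlands.Langlands.Theses.FiniteLevelTorsionSplit.closes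

end Summit.Langlands.Langlands.Theorems
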